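import Literature.MathematicalPhysics.QuantumFieldTheory.ConformalBootstrap3D.PointCertificateTwistGap
import Literature.MathematicalPhysics.QuantumFieldTheory.ConformalBootstrap3D.HRCoeffIntervalBounds

/-!
# Head cells strictly above the unitarity bound and the two-row table (lower boxes, REFEREE F61)

`boxExcluded_of_pointTable[_twist]` covers STRIP certificates: every head cell starts at
`a ≥ ℓ + 1` (the monotone coefficient bounds `hrCoeff_mem_Icc_cell`), so the `ℓ = 0` row starts at
`ε_lo ≥ 1`, and (O2)+(O3) come from ONE contiguous `ℓ = 0` row `ε_lo → E₀`. A certificate for a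
LOWER box `Δ_ε ∈ [ε_lo, ε_hi) ⊂ (1/2, 1)` (the band `[0.6, 0.95)` below the Ising window; its
functional is negative between `ε_hi` and `3`, as the generalised-free line forces) needs

* head cells on `(1/2, 1)` at `ℓ = 0`: here from the INTERVAL-RECURSION coefficient bounds
  `hrCoeffLo/Hi` (`hrCoeff_mem_Icc_interval`, valid on every cell strictly above the unitarity
  bound): `headCellSumI`, `blockPositive_pointFunctional_of_headSumI[_Ico]`,
  `headSumI_pointFunctional_of_pointRules` (tail terms by the twist-gap rule (M), cell start
  `a ≥ ℓ + τ`), corner/chord instances `headCellBoundI`/`headChordBoundI`, `headNumberI`,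
  `cell_of_headNumberI`; and a cell number with TWO rule bits (corner|chord) × (monotone|interval),
  `headNumber₂`, `cell_of_headNumber₂`;
* a two-row front end: an `ε`-ROW of `ℓ = 0` cells covering the `Δ_ε`-range of the box and,
  separately, the SCALAR ROW `t₀ ≤ 3 → E₀` for (O3) plus the spinning rows — `boxExcluded_of_pointTable₂`
  (a strip certificate uses an empty `ε`-row and puts its `Δ_ε`-range in the scalar row).

Term basis: Hogervorst–Rychkov 2013, §3 eq. (3.6)/(3.9). [cite: HogervorstRychkov2013, §3 eq. (3.9)]
-/

noncomputable section

namespace Literature.MathematicalPhysics.QuantumFieldTheory.ConformalBootstrap3D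

open Finset Set Filter Topology

/-! ### Head cells from the interval tables -/

/-- The head-cell sum with the INTERVAL coefficient bounds: for spin `ℓ`, cell `[a, b]`, head set
`F` and a table of per-term lower bounds `Φlo`,
`Σ_{(n,j) ∈ F} min(Lo_{n,j} Φlo_{n,j}, Hi_{n,j} Φlo_{n,j})`, `Lo/Hi = hrCoeffLo/Hi a b ℓ n j`.
[cite: HogervorstRychkov2013, §3 eq. (3.9)] -/
def headCellSumI (ℓ : ℕ) (a b : ℝ) (F : Finset (ℕ × ℕ)) (Φlo : ℕ × ℕ → ℝ) : ℝ :=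
  ∑ q ∈ F, min (hrCoeffLo a b ℓ q.1 q.2 * Φlo q) (hrCoeffHi a b ℓ q.1 q.2 * Φlo q)

/-- **Interval head cell rule, regular points.** Cell start STRICTLY above the unitarity bound
(`ℓ = 0`: `a > 1/2`); if `Φlo` bounds the head terms from below on the cell, `headCellSumI ≥ 0`, and
every term outside `F` on the descendant range is non-negative for `E ∈ [a+n, b+n]`, then `φ` is
block-positive at every REGULAR `Δ ∈ [a, b]`. [cite: HogervorstRychkov2013, §3 eq. (3.9)] -/
theorem blockPositive_pointFunctional_of_headSumI {N : ℕ} (w z zb : Fin N → ℝ)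
    (hz : ∀ k, z k ∈ Ioo (0 : ℝ) 1) (hzb : ∀ k, zb k ∈ Ioo (0 : ℝ) 1) {ℓ : ℕ} {a b s : ℝ}
    (ha : unitarityBound3D ℓ < a) (F : Finset (ℕ × ℕ)) (Φlo : ℕ × ℕ → ℝ)
    (hΦ : ∀ q ∈ F, ∀ Δ ∈ Icc a b,
      Φlo q ≤ pointFunctional w z zb (crossF s (-1) (zMono (Δ + (q.1 : ℝ)) q.2)))
    (hhead : 0 ≤ headCellSumI ℓ a b F Φlo)
    (htail : ∀ q : ℕ × ℕ, q ∉ F → InDescendantRange ℓ q.1 q.2 →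
      ∀ E ∈ Icc (a + q.1) (b + q.1), 0 ≤ pointFunctional w z zb (crossF s (-1) (zMono E q.2))) :
    ∀ Δ ∈ Icc a b, IsRegularPoint3D Δ ℓ → BlockPositive (pointFunctional w z zb) s Δ ℓ := by
  intro Δ hΔ hreg
  have hlt : unitarityBound3D ℓ < Δ := lt_of_lt_of_le ha hΔ.1
  refine blockPositive_pointFunctional_of_termwise w z zb hz hzb hlt hreg.2 F ?_ ?_
  · have hlam : 0 < legendreLam ℓ := legendreLam_pos ℓ
    have hterm : ∀ q ∈ F,
        (1 / legendreLam ℓ) *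
            min (hrCoeffLo a b ℓ q.1 q.2 * Φlo q) (hrCoeffHi a b ℓ q.1 q.2 * Φlo q) ≤
          hrCoeff Δ ℓ q.1 q.2 / legendreLam ℓ *
            pointFunctional w z zb (crossF s (-1) (zMono (Δ + (q.1 : ℝ)) q.2)) := by
      intro q hq
      have hA := hrCoeff_mem_Icc_interval ha hΔ.1 hΔ.2 q.1 q.2
      have hmin := min_mul_le_mul_of_bounds hA.2.1 hA.2.2 (hA.1.trans hA.2.1) (hΦ q hq Δ hΔ)
      have hrw : hrCoeff Δ ℓ q.1 q.2 / legendreLam ℓ *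
          pointFunctional w z zb (crossF s (-1) (zMono (Δ + (q.1 : ℝ)) q.2)) =
          (1 / legendreLam ℓ) * (hrCoeff Δ ℓ q.1 q.2 *
            pointFunctional w z zb (crossF s (-1) (zMono (Δ + (q.1 : ℝ)) q.2))) := by ring
      rw [hrw]
      exact mul_le_mul_of_nonneg_left hmin (by positivity)
    calc (0 : ℝ) ≤ (1 / legendreLam ℓ) * headCellSumI ℓ a b F Φlo :=
          mul_nonneg (by positivity) hhead
      _ = ∑ q ∈ F, (1 / legendreLam ℓ) *
            min (hrCoeffLo a b ℓ q.1 q.2 * Φlo q) (hrCoeffHi a b ℓ q.1 q.2 * Φlo q) := by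
          rw [headCellSumI, Finset.mul_sum]
      _ ≤ _ := Finset.sum_le_sum hterm
  · intro q hq hr
    exact htail q hq hr (Δ + (q.1 : ℝ)) ⟨by linarith [hΔ.1], by linarith [hΔ.2]⟩

/-- **Interval head cell rule, half-open cell**: every `Δ ∈ [a, b)`, accidental degeneracies by the
limit clause from the regular points to their right inside the cell.
[cite: HogervorstRychkov2013, §3 eq. (3.9)] -/
theorem blockPositive_pointFunctional_of_headSumI_Ico {N : ℕ} (w z zb : Fin N → ℝ)
    (hz : ∀ k, z k ∈ Ioo (0 : ℝ) 1) (hzb : ∀ k, zb k ∈ Ioo (0 : ℝ) 1) {ℓ : ℕ} {a b s : ℝ}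
    (ha : unitarityBound3D ℓ < a) (F : Finset (ℕ × ℕ)) (Φlo : ℕ × ℕ → ℝ)
    (hΦ : ∀ q ∈ F, ∀ Δ ∈ Icc a b,
      Φlo q ≤ pointFunctional w z zb (crossF s (-1) (zMono (Δ + (q.1 : ℝ)) q.2)))
    (hhead : 0 ≤ headCellSumI ℓ a b F Φlo)
    (htail : ∀ q : ℕ × ℕ, q ∉ F → InDescendantRange ℓ q.1 q.2 →
      ∀ E ∈ Icc (a + q.1) (b + q.1), 0 ≤ pointFunctional w z zb (crossF s (-1) (zMono E q.2))) :
    ∀ Δ ∈ Ico a b, BlockPositive (pointFunctional w z zb) s Δ ℓ := by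
  intro Δ hΔ
  have hreg := blockPositive_pointFunctional_of_headSumI w z zb hz hzb ha F Φlo hΦ hhead htail
  by_cases hr : IsRegularPoint3D Δ ℓ
  · exact hreg Δ ⟨hΔ.1, hΔ.2.le⟩ hr
  · have hbd : unitarityBound3D ℓ ≤ Δ := ha.le.trans hΔ.1
    refine blockPositive_of_eventually_right w z zb hz hzb s Δ ℓ hr ?_
    filter_upwards [eventually_isRegularPoint3D_nhdsGT_of_bound_le hbd, Ioo_mem_nhdsGT hΔ.2]
      with Δ' hΔ'reg hΔ'
    exact ⟨hΔ'reg, hreg Δ' ⟨hΔ.1.trans hΔ'.1.le, hΔ'.2.le⟩ hΔ'reg⟩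

/-- **Interval head cell from the certificate's global data (any table of term bounds).** The
external dimension runs over `Q`, `Φlo` bounds the head terms from below, and the tail terms are
discharged by the certificate's rules on the twist-gap domain: the cell starts at `a ≥ ℓ + τ`
(and strictly above the bound), every index outside `F` on the descendant range has `a + n ≥ E₀`,
so its terms live at `E ≥ a + n ≥ j + τ`, where (M) (`E < E_T`) or (T) (`E ≥ E_T`) applies.
[cite: HogervorstRychkov2013, §3 eq. (3.9)] -/
theorem headSumI_pointFunctional_of_pointRules {N : ℕ} (w z zb : Fin N → ℝ)
    (hz : ∀ k, z k ∈ Ioo (0 : ℝ) 1) (hzb : ∀ k, zb k ∈ Ioo (0 : ℝ) 1) (hord : ∀ k, zb k ≤ z k)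
    (apex : Fin N) (hapex : 0 ≤ w apex) (qd qr : Fin N → ℝ) (hqd : ∀ k, 0 < qd k ∧ qd k ≤ 1)
    (hqr : ∀ k, 0 < qr k ∧ qr k ≤ 1)
    (hdomd : ∀ k, z k * zb k ≤ qd k ^ 2 * (z apex * zb apex) ∧ z k ≤ qd k * z apex)
    (hdomr : ∀ k, (1 - z k) * (1 - zb k) ≤ qr k ^ 2 * (z apex * zb apex) ∧
      1 - zb k ≤ qr k * z apex)
    {Q : Set (ℝ × ℝ)} {slo shi E₀ ET τ : ℝ} (hQ : ∀ p ∈ Q, slo ≤ p.1 ∧ p.1 ≤ shi)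
    (hM : ∀ (j : ℕ) (E : ℝ), E₀ ≤ E → E < ET → (j : ℝ) + τ ≤ E → ∀ p ∈ Q,
      0 ≤ pointFunctional w z zb (crossF p.1 (-1) (zMono E j)))
    (hB : ∑ k ∈ univ.erase apex, |w k| * ((1 - z k) * (1 - zb k)) ^ slo * qd k ^ ET
          + ∑ k, |w k| * (z k * zb k) ^ slo * qr k ^ ET ≤
          w apex * ((1 - z apex) * (1 - zb apex)) ^ shi)
    {ℓ : ℕ} {a b : ℝ} (ha : unitarityBound3D ℓ < a) (haτ : (ℓ : ℝ) + τ ≤ a) (F : Finset (ℕ × ℕ))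
    (hF : ∀ q : ℕ × ℕ, q ∉ F → InDescendantRange ℓ q.1 q.2 → E₀ ≤ a + q.1)
    (Φlo : ℕ × ℕ → ℝ)
    (hΦ : ∀ q ∈ F, ∀ Δ ∈ Icc a b, ∀ p ∈ Q,
      Φlo q ≤ pointFunctional w z zb (crossF p.1 (-1) (zMono (Δ + (q.1 : ℝ)) q.2)))
    (hhead : 0 ≤ headCellSumI ℓ a b F Φlo) :
    ∀ p ∈ Q, ∀ Δ ∈ Ico a b, BlockPositive (pointFunctional w z zb) p.1 Δ ℓ := by
  intro p hp
  refine blockPositive_pointFunctional_of_headSumI_Ico w z zb hz hzb ha F Φlo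
    (fun q hq Δ hΔ => hΦ q hq Δ hΔ p hp) hhead ?_
  intro q hq hr E hE
  have h2 : (q.2 : ℝ) ≤ (ℓ : ℝ) + q.1 := by exact_mod_cast hr.2.1
  have hjb : (q.2 : ℝ) + τ ≤ E := by linarith [hE.1]
  have hjE : (q.2 : ℝ) ≤ E := by
    linarith [hE.1, natCast_add_half_le_unitarityBound3D ℓ]
  have hE0 : E₀ ≤ E := (hF q hq hr).trans hE.1
  by_cases hET : E < ET
  · exact hM q.2 E hE0 hET hjb p hp
  · have hBs := apexIneq_of_box w z zb hz hzb apex hapex qd qr (fun k => (hqd k).1.le)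
      (fun k => (hqr k).1.le) (hQ p hp) hB
    exact term_nonneg_of_apex w z zb hz hzb hord apex qd qr hqd hqr hdomd hdomr hBs hjE
      (not_lt.1 hET)

/-- The interval head-cell number with CORNER term bounds. [cite: HogervorstRychkov2013, §3 eq. (3.9)] -/
def headCellBoundI {N : ℕ} (w z zb : Fin N → ℝ) (ℓ : ℕ) (a b slo shi : ℝ)
    (F : Finset (ℕ × ℕ)) : ℝ :=
  headCellSumI ℓ a b F (fun q => termCornerBound w z zb q.2 (a + q.1) (b + q.1) slo shi)

/-- The interval head-cell number with CHORD term bounds. [cite: HogervorstRychkov2013, §3 eq. (3.9)] -/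
def headChordBoundI {N : ℕ} (w z zb : Fin N → ℝ) (ℓ : ℕ) (a b slo shi : ℝ)
    (F : Finset (ℕ × ℕ)) : ℝ :=
  headCellSumI ℓ a b F (fun q => termChordMin w z zb q.2 slo shi (a + q.1) (b + q.1))

/-- The number of an interval head cell on the canonical head set: corner (`useChord = false`) or
chord (`useChord = true`). [cite: HogervorstRychkov2013, §3 eq. (3.9)] -/
def headNumberI {N : ℕ} (w z zb : Fin N → ℝ) (ℓ : ℕ) (a b slo shi : ℝ) (nF : ℕ)
    (useChord : Bool) : ℝ :=
  if useChord then headChordBoundI w z zb ℓ a b slo shi (headSet ℓ nF)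
  else headCellBoundI w z zb ℓ a b slo shi (headSet ℓ nF)

/-- **One interval head cell from its number.** Cell start strictly above the unitarity bound and
`≥ ℓ + τ`; head level `n_F` with `a + n_F + 1 ≥ E₀`; chord cells with node ratios `≥ 1/2` for the
width. [cite: HogervorstRychkov2013, §3 eq. (3.9)] -/
theorem cell_of_headNumberI {N : ℕ} (w z zb : Fin N → ℝ)
    (hz : ∀ k, z k ∈ Ioo (0 : ℝ) 1) (hzb : ∀ k, zb k ∈ Ioo (0 : ℝ) 1) (hord : ∀ k, zb k ≤ z k)
    (apex : Fin N) (hapex : 0 ≤ w apex) (qd qr : Fin N → ℝ) (hqd : ∀ k, 0 < qd k ∧ qd k ≤ 1)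
    (hqr : ∀ k, 0 < qr k ∧ qr k ≤ 1)
    (hdomd : ∀ k, z k * zb k ≤ qd k ^ 2 * (z apex * zb apex) ∧ z k ≤ qd k * z apex)
    (hdomr : ∀ k, (1 - z k) * (1 - zb k) ≤ qr k ^ 2 * (z apex * zb apex) ∧
      1 - zb k ≤ qr k * z apex)
    {Q : Set (ℝ × ℝ)} {slo shi E₀ ET τ : ℝ} (hQ : ∀ p ∈ Q, slo ≤ p.1 ∧ p.1 ≤ shi)
    (hM : ∀ (j : ℕ) (E : ℝ), E₀ ≤ E → E < ET → (j : ℝ) + τ ≤ E → ∀ p ∈ Q,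
      0 ≤ pointFunctional w z zb (crossF p.1 (-1) (zMono E j)))
    (hB : ∑ k ∈ univ.erase apex, |w k| * ((1 - z k) * (1 - zb k)) ^ slo * qd k ^ ET
          + ∑ k, |w k| * (z k * zb k) ^ slo * qr k ^ ET ≤
          w apex * ((1 - z apex) * (1 - zb apex)) ^ shi)
    (hr : ∀ k, 1 / 2 ≤ ((1 - z k) * (1 - zb k)) ^ (shi - slo) ∧ 1 / 2 ≤ (z k * zb k) ^ (shi - slo))
    {ℓ : ℕ} {a b : ℝ} (ha : unitarityBound3D ℓ < a) (haτ : (ℓ : ℝ) + τ ≤ a) (nF : ℕ)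
    (hnF : E₀ ≤ a + ((nF : ℝ) + 1)) (useChord : Bool)
    (hρ : useChord = true → ∀ k, 1 / 2 ≤ (z k * zb k) ^ ((b - a) / 2) ∧
      1 / 2 ≤ ((1 - z k) * (1 - zb k)) ^ ((b - a) / 2))
    (hnum : 0 ≤ headNumberI w z zb ℓ a b slo shi nF useChord) :
    ∀ p ∈ Q, ∀ Δ ∈ Ico a b, BlockPositive (pointFunctional w z zb) p.1 Δ ℓ := by
  cases useChord with
  | true =>
    have hnum' : 0 ≤ headChordBoundI w z zb ℓ a b slo shi (headSet ℓ nF) := by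
      simpa [headNumberI] using hnum
    refine headSumI_pointFunctional_of_pointRules w z zb hz hzb hord apex hapex qd qr hqd hqr hdomd
      hdomr hQ hM hB ha haτ (headSet ℓ nF) (headSet_off hnF) _ ?_ hnum'
    intro q _ Δ hΔ p hp
    have hρ' : ∀ k, 1 / 2 ≤ (z k * zb k) ^ ((b + (q.1 : ℝ) - (a + q.1)) / 2) ∧
        1 / 2 ≤ ((1 - z k) * (1 - zb k)) ^ ((b + (q.1 : ℝ) - (a + q.1)) / 2) := by
      intro k; rw [show b + (q.1 : ℝ) - (a + q.1) = b - a by ring]; exact hρ rfl k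
    exact termChordMin_le w z zb hz hzb q.2 hr hρ' ⟨(hQ p hp).1, (hQ p hp).2⟩
      (⟨by linarith [hΔ.1], by linarith [hΔ.2]⟩ : Δ + (q.1 : ℝ) ∈ Icc (a + q.1) (b + q.1))
  | false =>
    have hnum' : 0 ≤ headCellBoundI w z zb ℓ a b slo shi (headSet ℓ nF) := by
      simpa [headNumberI] using hnum
    refine headSumI_pointFunctional_of_pointRules w z zb hz hzb hord apex hapex qd qr hqd hqr hdomd
      hdomr hQ hM hB ha haτ (headSet ℓ nF) (headSet_off hnF) _ ?_ hnum'
    intro q _ Δ hΔ p hp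
    exact termCornerBound_le w z zb hz hzb q.2
      (⟨by linarith [hΔ.1], by linarith [hΔ.2]⟩ : Δ + (q.1 : ℝ) ∈ Icc (a + q.1) (b + q.1))
      ⟨(hQ p hp).1, (hQ p hp).2⟩

/-! ### A head cell with two rule bits -/

/-- The number of a head cell with two rule bits: term bounds corner/chord (`useChord`) and
coefficient bounds monotone (`hrCoeff_mem_Icc_cell`, cell start `≥ ℓ + 1`) / interval
(`hrCoeff_mem_Icc_interval`, cell start `> unitarityBound3D ℓ`) (`useInterval`).
[cite: HogervorstRychkov2013, §3 eq. (3.9)] -/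
def headNumber₂ {N : ℕ} (w z zb : Fin N → ℝ) (ℓ : ℕ) (a b slo shi : ℝ) (nF : ℕ)
    (useChord useInterval : Bool) : ℝ :=
  if useInterval then headNumberI w z zb ℓ a b slo shi nF useChord
  else headNumber w z zb ℓ a b slo shi nF useChord

/-- **One head cell from its two-bit number.** Monotone cells need `a ≥ ℓ + 1`; interval cells
need `a > unitarityBound3D ℓ` and `a ≥ ℓ + τ`. [cite: HogervorstRychkov2013, §3 eq. (3.9)] -/
theorem cell_of_headNumber₂ {N : ℕ} (w z zb : Fin N → ℝ)
    (hz : ∀ k, z k ∈ Ioo (0 : ℝ) 1) (hzb : ∀ k, zb k ∈ Ioo (0 : ℝ) 1) (hord : ∀ k, zb k ≤ z k)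
    (apex : Fin N) (hapex : 0 ≤ w apex) (qd qr : Fin N → ℝ) (hqd : ∀ k, 0 < qd k ∧ qd k ≤ 1)
    (hqr : ∀ k, 0 < qr k ∧ qr k ≤ 1)
    (hdomd : ∀ k, z k * zb k ≤ qd k ^ 2 * (z apex * zb apex) ∧ z k ≤ qd k * z apex)
    (hdomr : ∀ k, (1 - z k) * (1 - zb k) ≤ qr k ^ 2 * (z apex * zb apex) ∧
      1 - zb k ≤ qr k * z apex)
    {Q : Set (ℝ × ℝ)} {slo shi E₀ ET τ : ℝ} (hQ : ∀ p ∈ Q, slo ≤ p.1 ∧ p.1 ≤ shi) (hτ1 : τ ≤ 1)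
    (hM : ∀ (j : ℕ) (E : ℝ), E₀ ≤ E → E < ET → (j : ℝ) + τ ≤ E → ∀ p ∈ Q,
      0 ≤ pointFunctional w z zb (crossF p.1 (-1) (zMono E j)))
    (hB : ∑ k ∈ univ.erase apex, |w k| * ((1 - z k) * (1 - zb k)) ^ slo * qd k ^ ET
          + ∑ k, |w k| * (z k * zb k) ^ slo * qr k ^ ET ≤
          w apex * ((1 - z apex) * (1 - zb apex)) ^ shi)
    (hr : ∀ k, 1 / 2 ≤ ((1 - z k) * (1 - zb k)) ^ (shi - slo) ∧ 1 / 2 ≤ (z k * zb k) ^ (shi - slo))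
    {ℓ : ℕ} {a b : ℝ} (nF : ℕ) (hnF : E₀ ≤ a + ((nF : ℝ) + 1)) (useChord useInterval : Bool)
    (h1 : useInterval = false → (ℓ : ℝ) + 1 ≤ a)
    (h2 : useInterval = true → unitarityBound3D ℓ < a ∧ (ℓ : ℝ) + τ ≤ a)
    (hρ : useChord = true → ∀ k, 1 / 2 ≤ (z k * zb k) ^ ((b - a) / 2) ∧
      1 / 2 ≤ ((1 - z k) * (1 - zb k)) ^ ((b - a) / 2))
    (hnum : 0 ≤ headNumber₂ w z zb ℓ a b slo shi nF useChord useInterval) :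
    ∀ p ∈ Q, ∀ Δ ∈ Ico a b, BlockPositive (pointFunctional w z zb) p.1 Δ ℓ := by
  cases useInterval with
  | true =>
    have hnum' : 0 ≤ headNumberI w z zb ℓ a b slo shi nF useChord := by
      simpa [headNumber₂] using hnum
    exact cell_of_headNumberI w z zb hz hzb hord apex hapex qd qr hqd hqr hdomd hdomr hQ hM hB hr
      (h2 rfl).1 (h2 rfl).2 nF hnF useChord hρ hnum'
  | false =>
    have hnum' : 0 ≤ headNumber w z zb ℓ a b slo shi nF useChord := by
      simpa [headNumber₂] using hnum
    exact cell_of_headNumber_twist w z zb hz hzb hord apex hapex qd qr hqd hqr hdomd hdomr hQ hτ1 hM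
      hB hr (h1 rfl) nF hnF useChord hρ hnum'

/-! ### The two-row table -/

/-- **The point-functional certificate as a finite table, two `ℓ = 0` rows (lower boxes).**
Nodes/apex/domination data as in `boxExcluded_of_pointTable`; twist gap `τ ≤ 1`, `τ ≤ E₀`;
the box `Q ⊆ [s_lo, s_hi] × ([ε_lo, ε_hi) ∪ [t_{0,0}, E₀))`. HEAD DATA: an `ε`-ROW of `ℓ = 0`
cells `tε 0 = ε_lo, …, tε Kε = ε_hi` (may be empty, `Kε = 0`, `ε_lo = ε_hi`), the SCALAR ROW
`t 0 0 ≤ 3, …, t 0 (K 0) = E₀`, and for every even `0 < ℓ < L` (`E₀ ≤ L + 1`) a row from `ℓ + 1`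
to `E₀`; every cell carries a head level `n_F` (`a + n_F + 1 ≥ E₀`), a term-rule bit (corner/chord,
chord cells with node ratios `≥ 1/2` for the width) and a coefficient-rule bit (monotone: cell start
`≥ ℓ + 1`; interval: cell start `> unitarityBound3D ℓ` — i.e. `> 1/2` at `ℓ = 0` — and `≥ ℓ + τ`),
and ONE number `headNumber₂ ≥ 0`. (M) box rows for `j + τ < E_T` from `≤ max(E₀, j + τ)` to
`≥ E_T` with `boxNumber ≥ 0`; (O1) the identity corner number `> 0`; (T) the apex inequality at
`E_T`; the `s`-width side condition. CONCLUSION: `BoxExcluded Q`.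
[cite: HogervorstRychkov2013, §3 eq. (3.6)] -/
theorem boxExcluded_of_pointTable₂ {N : ℕ} {w z zb : Fin N → ℝ}
    (hz : ∀ k, z k ∈ Ioo (0 : ℝ) 1) (hzb : ∀ k, zb k ∈ Ioo (0 : ℝ) 1) (hord : ∀ k, zb k ≤ z k)
    (apex : Fin N) (hapex : 0 ≤ w apex) (qd qr : Fin N → ℝ) (hqd : ∀ k, 0 < qd k ∧ qd k ≤ 1)
    (hqr : ∀ k, 0 < qr k ∧ qr k ≤ 1)
    (hdomd : ∀ k, z k * zb k ≤ qd k ^ 2 * (z apex * zb apex) ∧ z k ≤ qd k * z apex)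
    (hdomr : ∀ k, (1 - z k) * (1 - zb k) ≤ qr k ^ 2 * (z apex * zb apex) ∧
      1 - zb k ≤ qr k * z apex)
    {Q : Set (ℝ × ℝ)} {slo shi εlo εhi E₀ ET τ : ℝ}
    (t : ℕ → ℕ → ℝ) (K : ℕ → ℕ) (nF : ℕ → ℕ → ℕ) (hc hi : ℕ → ℕ → Bool)
    (tε : ℕ → ℝ) (Kε : ℕ) (nFε : ℕ → ℕ) (hcε hiε : ℕ → Bool)
    (hQ : ∀ p ∈ Q, (slo ≤ p.1 ∧ p.1 ≤ shi) ∧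
      ((εlo ≤ p.2 ∧ p.2 < εhi) ∨ (t 0 0 ≤ p.2 ∧ p.2 < E₀)))
    (L : ℕ) (hL : E₀ ≤ (L : ℝ) + 1) (hτ1 : τ ≤ 1) (hτ0 : τ ≤ E₀)
    (hr : ∀ k, 1 / 2 ≤ ((1 - z k) * (1 - zb k)) ^ (shi - slo) ∧ 1 / 2 ≤ (z k * zb k) ^ (shi - slo))
    -- (O1)
    (hI : 0 < termCornerBound w z zb 0 0 0 slo shi)
    -- the ε-row (ℓ = 0)
    (htε : tε 0 = εlo ∧ tε Kε = εhi)
    (hlowε1 : ∀ k, k < Kε → hiε k = false → 1 ≤ tε k)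
    (hlowεI : ∀ k, k < Kε → hiε k = true → 1 / 2 < tε k ∧ τ ≤ tε k)
    (hnFε : ∀ k, k < Kε → E₀ ≤ tε k + ((nFε k : ℝ) + 1))
    (hρε : ∀ k, k < Kε → hcε k = true → ∀ i, 1 / 2 ≤ (z i * zb i) ^ ((tε (k + 1) - tε k) / 2) ∧
      1 / 2 ≤ ((1 - z i) * (1 - zb i)) ^ ((tε (k + 1) - tε k) / 2))
    (hheadε : ∀ k < Kε, 0 ≤ headNumber₂ w z zb 0 (tε k) (tε (k + 1)) slo shi (nFε k) (hcε k) (hiε k))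
    -- the scalar row (ℓ = 0, from ≤ 3 to E₀) and the spinning rows (even 0 < ℓ < L, ℓ+1 to E₀)
    (ht0 : t 0 0 ≤ 3 ∧ t 0 (K 0) = E₀)
    (htℓ : ∀ ℓ, Even ℓ → ℓ ≠ 0 → ℓ < L → t ℓ 0 = (ℓ : ℝ) + 1 ∧ t ℓ (K ℓ) = E₀)
    (hlow1 : ∀ ℓ k, k < K ℓ → hi ℓ k = false → (ℓ : ℝ) + 1 ≤ t ℓ k)
    (hlowI : ∀ ℓ k, k < K ℓ → hi ℓ k = true → unitarityBound3D ℓ < t ℓ k ∧ (ℓ : ℝ) + τ ≤ t ℓ k)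
    (hnF : ∀ ℓ k, k < K ℓ → E₀ ≤ t ℓ k + ((nF ℓ k : ℝ) + 1))
    (hρ : ∀ ℓ k, k < K ℓ → hc ℓ k = true → ∀ i, 1 / 2 ≤ (z i * zb i) ^ ((t ℓ (k + 1) - t ℓ k) / 2) ∧
      1 / 2 ≤ ((1 - z i) * (1 - zb i)) ^ ((t ℓ (k + 1) - t ℓ k) / 2))
    (hhead : ∀ ℓ, (ℓ = 0 ∨ (Even ℓ ∧ ℓ < L)) → ∀ k < K ℓ,
      0 ≤ headNumber₂ w z zb ℓ (t ℓ k) (t ℓ (k + 1)) slo shi (nF ℓ k) (hc ℓ k) (hi ℓ k))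
    -- (M) box rows, twist-gap domain
    (e : ℕ → ℕ → ℝ) (M : ℕ → ℕ) (bc : ℕ → ℕ → Bool)
    (he : ∀ j : ℕ, (j : ℝ) + τ < ET → e j 0 ≤ max E₀ ((j : ℝ) + τ) ∧ ET ≤ e j (M j))
    (hρM : ∀ j m, m < M j → bc j m = true → ∀ k, 1 / 2 ≤ (z k * zb k) ^ ((e j (m + 1) - e j m) / 2) ∧
      1 / 2 ≤ ((1 - z k) * (1 - zb k)) ^ ((e j (m + 1) - e j m) / 2))
    (hbox : ∀ j : ℕ, (j : ℝ) + τ < ET → ∀ m < M j,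
      0 ≤ boxNumber w z zb j (e j m) (e j (m + 1)) slo shi (bc j m))
    -- (T)
    (hB : ∑ k ∈ univ.erase apex, |w k| * ((1 - z k) * (1 - zb k)) ^ slo * qd k ^ ET
          + ∑ k, |w k| * (z k * zb k) ^ slo * qr k ^ ET ≤
          w apex * ((1 - z apex) * (1 - zb apex)) ^ shi) :
    BoxExcluded Q := by
  have hQ1 : ∀ p ∈ Q, slo ≤ p.1 ∧ p.1 ≤ shi := fun p hp => (hQ p hp).1
  have hM := ruleM_of_boxTable_twist w z zb hz hzb τ hQ1 hr e M bc he hρM hbox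
  -- every cell of the scalar and spinning rows
  have hcell : ∀ ℓ, (ℓ = 0 ∨ (Even ℓ ∧ ℓ < L)) → ∀ k < K ℓ, ∀ p ∈ Q,
      ∀ Δ ∈ Ico (t ℓ k) (t ℓ (k + 1)), BlockPositive (pointFunctional w z zb) p.1 Δ ℓ :=
    fun ℓ hℓ k hk => cell_of_headNumber₂ w z zb hz hzb hord apex hapex qd qr hqd hqr hdomd hdomr
      hQ1 hτ1 hM hB hr (nF ℓ k) (hnF ℓ k hk) (hc ℓ k) (hi ℓ k) (hlow1 ℓ k hk) (hlowI ℓ k hk)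
      (hρ ℓ k hk) (hhead ℓ hℓ k hk)
  -- every cell of the ε-row
  have hb0 : unitarityBound3D 0 = 1 / 2 := by simp [unitarityBound3D]
  have hcellε : ∀ k < Kε, ∀ p ∈ Q,
      ∀ Δ ∈ Ico (tε k) (tε (k + 1)), BlockPositive (pointFunctional w z zb) p.1 Δ 0 :=
    fun k hk => cell_of_headNumber₂ w z zb hz hzb hord apex hapex qd qr hqd hqr hdomd hdomr
      hQ1 hτ1 hM hB hr (nFε k) (hnFε k hk) (hcε k) (hiε k)
      (fun h => by simpa using hlowε1 k hk h)
      (fun h => by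
        obtain ⟨h1, h2⟩ := hlowεI k hk h
        exact ⟨by rw [hb0]; exact h1, by simpa using h2⟩)
      (hρε k hk) (hheadε k hk)
  refine boxExcluded_of_pointRules_twist hz hzb hord apex hapex qd qr hqd hqr hdomd hdomr hQ1 hτ1 hτ0
    hI ?_ ?_ ?_ hM hB
  · -- (O2): `Δ_ε` lies in the ε-row or in the scalar row
    intro p hp
    rcases (hQ p hp).2 with hε | h0
    · exact blockPositive_of_cells_Ico tε Kε hcellε p hp p.2 ⟨htε.1 ▸ hε.1, htε.2 ▸ hε.2⟩
    · exact blockPositive_of_cells_Ico (t 0) (K 0) (hcell 0 (Or.inl rfl)) p hp p.2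
        ⟨h0.1, ht0.2 ▸ h0.2⟩
  · -- (O3)
    exact scalar_nonneg_of_cells (t 0) (K 0) ht0.1 ht0.2 (hcell 0 (Or.inl rfl))
  · -- (O4)
    exact spinning_nonneg_of_cells L hL t K (fun ℓ hev hℓ hℓL => (htℓ ℓ hev hℓ hℓL).1.le)
      (fun ℓ hev hℓ hℓL => (htℓ ℓ hev hℓ hℓL).2)
      (fun ℓ hev hℓ hℓL => hcell ℓ (Or.inr ⟨hev, hℓL⟩))

end Literature.MathematicalPhysics.QuantumFieldTheory.ConformalBootstrap3D
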